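import Literature.Barriers.CriticalPhenomena.PlaquetteWalkAngleLimitZeta
import HarnessLib

/-!
# Barrier catalogue (SAWScalingLimit): eighth-root phase sums — the four coordinates, and ANTIPODE-FREE phase sets cannot cancel
(«ANTIPODE-FREE PHASES»)

Companion of `PlaquetteWalkAngleLimitZeta` (`zeta32 = ζ = e^{iπ/16}`, sixteen coordinates). By the PHASE LAW (`PlaquetteWalkAngleLimitPhase`) the limit weight of a
walk of the `Z → ∞` model is `± (i√2)^m · ζ₈^X`, `ζ₈ = ζ⁴`; at a fixed level all wound members at a cell of the hole column share `m`, so the level-`j` wound sum is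
`(i√2)^m · Σ_{k<8} N_k ζ^{4k}` with `N_k ∈ ℕ` the number of members of phase `k`. This file records the exact cancellation criterion:

* ★★ `sum_zeta32_pow_four_eq_zero_iff` — **`Σ_{k<8} N_k ζ^{4k} = 0 ⟺ N₀ = N₄ ∧ N₁ = N₅ ∧ N₂ = N₆ ∧ N₃ = N₇`** (integer coefficients; `ζ¹⁶ = −1` and the sixteen
  coordinates of `ℚ(ζ)`): an eighth-root phase sum vanishes iff every ANTIPODAL pair of phases is balanced;
* ★★ `eq_zero_of_antipodeFree` — if no antipodal pair `{k, k+4}` is doubly occupied, the sum vanishes only when every `N_k = 0`;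
* ★★★ `sum_phases_above_eq_zero_iff` / `sum_phases_below_eq_zero_iff` — the two ANTIPODE-FREE sets of the lane's census law in the hole column
  (FINDING-YB-HOLE-COLUMN-FOUR-PHASE: at the cells `(w.1 − 1, w.2 + y)` every cost-`7` wound member has phase in `{1,2,4,7}` for `y ≥ 1`, in `{0,2,5,7}` for
  `y ≤ −1`; kit j298353, 2 250 cells, no exception): `N₁ζ⁴ + N₂ζ⁸ + N₄ζ¹⁶ + N₇ζ²⁸ = 0 ⟺ N₁ = N₂ = N₄ = N₇ = 0`, and the same for `{0,2,5,7}` — so in the hole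
  column the level-`7` wound sum vanishes iff there is no member, although the four phase directions do NOT lie in a half-plane.

Elementary (cyclotomic coordinates). [GlazmanManolescu2019 §1 eq. (1), Lemma 2.1 (the `Z → ∞` bookkeeping is lane plumbing on the printed weights)]
-/

noncomputable section

namespace Literature.Barriers.CriticalPhenomena.PlaquetteWalk

open Complex

/-! ## Eight phases, four coordinates -/

/-- ★★ **THE FOUR COORDINATES OF AN EIGHTH-ROOT PHASE SUM**: with `ζ = e^{iπ/16}` (so `ζ⁴ = ζ₈`, `ζ¹⁶ = −1`),
`N₀ + N₁ζ⁴ + N₂ζ⁸ + N₃ζ¹² + N₄ζ¹⁶ + N₅ζ²⁰ + N₆ζ²⁴ + N₇ζ²⁸ = 0 ⟺ N₀ = N₄ ∧ N₁ = N₅ ∧ N₂ = N₆ ∧ N₃ = N₇` for integers `N_k`.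
[cite: GlazmanManolescu2019, §1, eq. (1) (standard cyclotomic algebra; lane plumbing for the exact census)] -/
theorem sum_zeta32_pow_four_eq_zero_iff (N₀ N₁ N₂ N₃ N₄ N₅ N₆ N₇ : ℤ) :
    (N₀ : ℂ) + N₁ * zeta32 ^ 4 + N₂ * zeta32 ^ 8 + N₃ * zeta32 ^ 12 + N₄ * zeta32 ^ 16 + N₅ * zeta32 ^ 20 + N₆ * zeta32 ^ 24 +
        N₇ * zeta32 ^ 28 = 0 ↔
      N₀ = N₄ ∧ N₁ = N₅ ∧ N₂ = N₆ ∧ N₃ = N₇ := by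
  have h16 : zeta32 ^ 16 = -1 := zeta32_pow_sixteen
  constructor
  · intro h
    -- the reduced combination `(N₀−N₄) + (N₁−N₅)ζ⁴ + (N₂−N₆)ζ⁸ + (N₃−N₇)ζ¹²` vanishes
    have hred : ((N₀ - N₄ : ℤ) : ℂ) + ((N₁ - N₅ : ℤ) : ℂ) * zeta32 ^ 4 + ((N₂ - N₆ : ℤ) : ℂ) * zeta32 ^ 8 +
        ((N₃ - N₇ : ℤ) : ℂ) * zeta32 ^ 12 = 0 := by
      push_cast
      linear_combination h - ((N₄ : ℂ) + (N₅ : ℂ) * zeta32 ^ 4 + (N₆ : ℂ) * zeta32 ^ 8 + (N₇ : ℂ) * zeta32 ^ 12) * h16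
    -- as a sixteen-coordinate vector
    let c : Fin 16 → ℤ := ![N₀ - N₄, 0, 0, 0, N₁ - N₅, 0, 0, 0, N₂ - N₆, 0, 0, 0, N₃ - N₇, 0, 0, 0]
    have hsum : ∑ i : Fin 16, (c i : ℂ) * zeta32 ^ (i : ℕ) = 0 := by
      rw [← hred]
      simp [Fin.sum_univ_succ, c]
      ring
    have hz := eq_zero_of_sum_zeta32_pow_eq_zero_int c hsum
    have e0 : N₀ - N₄ = 0 := hz 0
    have e1 : N₁ - N₅ = 0 := hz 4
    have e2 : N₂ - N₆ = 0 := hz 8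
    have e3 : N₃ - N₇ = 0 := hz 12
    omega
  · rintro ⟨e0, e1, e2, e3⟩
    rw [e0, e1, e2, e3]
    linear_combination ((N₄ : ℂ) + (N₅ : ℂ) * zeta32 ^ 4 + (N₆ : ℂ) * zeta32 ^ 8 + (N₇ : ℂ) * zeta32 ^ 12) * h16

/-- ★★ **ANTIPODE-FREE PHASE SETS CANNOT CANCEL**: if for every `k < 4` at most one of the phases `k`, `k + 4` is occupied (`N_k = 0 ∨ N_{k+4} = 0`), then the
eighth-root phase sum with NATURAL coefficients vanishes only if every `N_k = 0`. [cite: GlazmanManolescu2019, §1, eq. (1) (standard cyclotomic algebra; lane plumbing)] -/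
theorem eq_zero_of_antipodeFree (N₀ N₁ N₂ N₃ N₄ N₅ N₆ N₇ : ℕ) (a0 : N₀ = 0 ∨ N₄ = 0) (a1 : N₁ = 0 ∨ N₅ = 0) (a2 : N₂ = 0 ∨ N₆ = 0)
    (a3 : N₃ = 0 ∨ N₇ = 0)
    (h : (N₀ : ℂ) + N₁ * zeta32 ^ 4 + N₂ * zeta32 ^ 8 + N₃ * zeta32 ^ 12 + N₄ * zeta32 ^ 16 + N₅ * zeta32 ^ 20 + N₆ * zeta32 ^ 24 +
        N₇ * zeta32 ^ 28 = 0) :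
    N₀ = 0 ∧ N₁ = 0 ∧ N₂ = 0 ∧ N₃ = 0 ∧ N₄ = 0 ∧ N₅ = 0 ∧ N₆ = 0 ∧ N₇ = 0 := by
  have h' : ((N₀ : ℤ) : ℂ) + ((N₁ : ℤ) : ℂ) * zeta32 ^ 4 + ((N₂ : ℤ) : ℂ) * zeta32 ^ 8 + ((N₃ : ℤ) : ℂ) * zeta32 ^ 12 +
      ((N₄ : ℤ) : ℂ) * zeta32 ^ 16 + ((N₅ : ℤ) : ℂ) * zeta32 ^ 20 + ((N₆ : ℤ) : ℂ) * zeta32 ^ 24 + ((N₇ : ℤ) : ℂ) * zeta32 ^ 28 = 0 := by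
    push_cast; exact h
  obtain ⟨e0, e1, e2, e3⟩ := (sum_zeta32_pow_four_eq_zero_iff _ _ _ _ _ _ _ _).1 h'
  omega

/-! ## The two antipode-free sets of the hole column -/

/-- ★★★ **THE PHASE SET `{1, 2, 4, 7}` CANNOT CANCEL** (the cost-`7` wound members at a hole-column cell ABOVE the hole, FINDING-YB-HOLE-COLUMN-FOUR-PHASE):
`N₁ζ⁴ + N₂ζ⁸ + N₄ζ¹⁶ + N₇ζ²⁸ = 0 ⟺ N₁ = N₂ = N₄ = N₇ = 0`, for integers. [cite: GlazmanManolescu2019, §1, eq. (1) and Lemma 2.1 (lane plumbing: the `Z → ∞` phase sum)] -/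
theorem sum_phases_above_eq_zero_iff (N₁ N₂ N₄ N₇ : ℤ) :
    (N₁ : ℂ) * zeta32 ^ 4 + N₂ * zeta32 ^ 8 + N₄ * zeta32 ^ 16 + N₇ * zeta32 ^ 28 = 0 ↔ N₁ = 0 ∧ N₂ = 0 ∧ N₄ = 0 ∧ N₇ = 0 := by
  have key := sum_zeta32_pow_four_eq_zero_iff 0 N₁ N₂ 0 N₄ 0 0 N₇
  constructor
  · intro h
    have h' : ((0 : ℤ) : ℂ) + N₁ * zeta32 ^ 4 + N₂ * zeta32 ^ 8 + ((0 : ℤ) : ℂ) * zeta32 ^ 12 + N₄ * zeta32 ^ 16 + ((0 : ℤ) : ℂ) * zeta32 ^ 20 +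
        ((0 : ℤ) : ℂ) * zeta32 ^ 24 + N₇ * zeta32 ^ 28 = 0 := by
      push_cast; linear_combination h
    obtain ⟨e0, e1, e2, e3⟩ := key.1 h'
    omega
  · rintro ⟨e1, e2, e4, e7⟩
    rw [e1, e2, e4, e7]; push_cast; ring

/-- ★★★ **THE PHASE SET `{0, 2, 5, 7}` CANNOT CANCEL** (the cost-`7` wound members at a hole-column cell BELOW the hole):
`N₀ + N₂ζ⁸ + N₅ζ²⁰ + N₇ζ²⁸ = 0 ⟺ N₀ = N₂ = N₅ = N₇ = 0`, for integers. [cite: GlazmanManolescu2019, §1, eq. (1) and Lemma 2.1 (lane plumbing: the `Z → ∞` phase sum)] -/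
theorem sum_phases_below_eq_zero_iff (N₀ N₂ N₅ N₇ : ℤ) :
    (N₀ : ℂ) + N₂ * zeta32 ^ 8 + N₅ * zeta32 ^ 20 + N₇ * zeta32 ^ 28 = 0 ↔ N₀ = 0 ∧ N₂ = 0 ∧ N₅ = 0 ∧ N₇ = 0 := by
  have key := sum_zeta32_pow_four_eq_zero_iff N₀ 0 N₂ 0 0 N₅ 0 N₇
  constructor
  · intro h
    have h' : (N₀ : ℂ) + ((0 : ℤ) : ℂ) * zeta32 ^ 4 + N₂ * zeta32 ^ 8 + ((0 : ℤ) : ℂ) * zeta32 ^ 12 + ((0 : ℤ) : ℂ) * zeta32 ^ 16 + N₅ * zeta32 ^ 20 +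
        ((0 : ℤ) : ℂ) * zeta32 ^ 24 + N₇ * zeta32 ^ 28 = 0 := by
      push_cast; linear_combination h
    obtain ⟨e0, e1, e2, e3⟩ := key.1 h'
    omega
  · rintro ⟨e0, e2, e5, e7⟩
    rw [e0, e2, e5, e7]; push_cast; ring

end Literature.Barriers.CriticalPhenomena.PlaquetteWalk
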